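import Mathlib
import Summits.KontsevichZagierPeriods.KontsevichZagierPeriods.Theorems.IsogenyCertificatesRichelotChainCerts
import Summits.KontsevichZagierPeriods.KontsevichZagierPeriods.Theorems.IsogenyCertificatesRichelotChainCorr

/-!
# `RichelotChain` (stmt-KontsevichZagierPeriods-6732): the interval `(−15, 9) ↔ (0, 6)`

First bounded root intervals of `Ĉ : w² = F̂(z) = (z+15)(z−9)(z−10)(z−34)(z−36)(z−60)` and
`C : y² = F(x) = x(x−6)(x−13)(x−30)(x−40)(x−45)` (`F̂ < 0`, `F < 0` there):
`[(−15,9), (α+βz)/√|F̂|] ~ [(0,6), (α+βx)/√|F|]` in the Kontsevich–Zagier calculus, by the two real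
sheets of the Richelot correspondence `Z₁ : Φ⁰(x,z) = 0` over `z ∈ (−15,0)` and `z ∈ (0,9)`, each the
smaller `x`-root of `Φ⁰(·,z)`, mapping onto `(0,6)` (the larger root lies in `(13,30)`); the trace of
`(α+βz)dz/w` over the two `z`-roots is `(α+βx)dx/y` (`cert0_trace_x`). All interval-specific input is
sign bookkeeping of explicit polynomials with rational roots:
`disc_x Φ⁰ = −25(z+18)(z−10)(z−34)(23z−1530)`, `disc_z Φ⁰ = −8x(11x−170)(23x−650)(x−45)`,
`Φ⁰(0,z) = 650z²`, `Φ⁰(6,z) = 416(z+15)(z−9)`, `Φ⁰(13,z) = 234(z+15)(z−9)`, `Φ⁰(30,z) = 200(z−36)(z−60)`,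
`Φ⁰(x,−15) = 1875(x−6)(x−13)`, `Φ⁰(x,0) = 90x(11x−170)`, `Φ⁰(x,x) = x(x−45)(x−10)(x−34)`,
`Φ⁰(x,9) = 675(x−6)(x−13)`.

References: J.-B. Bost, J.-F. Mestre, Gaz. Math. 38 (1988), §2; M. Kontsevich, D. Zagier, *Periods*
(2001), §1.2.
-/

noncomputable section

open Set MeasureTheory
open Literature.NumberTheory.Transcendental Literature.ModelTheory.ExponentialFields

namespace Summit.KontsevichZagierPeriods.IsogenyCertificates.RichelotChain

/-- **`RichelotChain`, interval `k = 0`:** `[(−15,9), (α+βz)/√|F̂|] ~ [(0,6), 1·(α+βx)/√|F|]`.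
[cite: BostMestre1988, §2] -/
theorem sheet_k0 (α β : ℚ) (r r' : KZ.IntegralRep 1)
    (h1 : r.domain = {z | (-15 : ℝ) < z 0 ∧ z 0 < 9})
    (h2 : EqOn r.integrand (fun z => ((α : ℝ) + (β : ℝ) * z 0) /
      Real.sqrt |(z 0 + 15) * (z 0 - 9) * (z 0 - 10) * (z 0 - 34) * (z 0 - 36) * (z 0 - 60)|) r.domain)
    (h3 : r'.domain = {x | (0 : ℝ) < x 0 ∧ x 0 < 6})
    (h4 : EqOn r'.integrand (fun x => (1 : ℝ) * ((α : ℝ) + (β : ℝ) * x 0) /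
      Real.sqrt |x 0 * (x 0 - 6) * (x 0 - 13) * (x 0 - 30) * (x 0 - 40) * (x 0 - 45)|) r'.domain) :
    KZ.Equivalent r r' := by
  -- the data of the correspondence `Z₁`, in the `x`-root direction
  set a : ℝ → ℝ := fun t => t ^ 2 - 44 * t + 990 with ha_def
  set b : ℝ → ℝ := fun t => -45 * t ^ 2 + 680 * t - 15300 with hb_def
  set c : ℝ → ℝ := fun t => 650 * t ^ 2 with hc_def
  set a₁ : ℝ → ℝ := fun t => 2 * t - 44 with ha₁_def
  set b₁ : ℝ → ℝ := fun t => -90 * t + 680 with hb₁_def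
  set c₁ : ℝ → ℝ := fun t => 1300 * t with hc₁_def
  set P : ℝ → ℝ := fun y => y ^ 2 - 45 * y + 650 with hP_def
  set Q : ℝ → ℝ := fun y => -44 * y ^ 2 + 680 * y with hQ_def
  set R : ℝ → ℝ := fun y => 990 * y ^ 2 - 15300 * y with hR_def
  set Ft : ℝ → ℝ := fun y => y * (y - 6) * (y - 13) * (y - 30) * (y - 40) * (y - 45) with hFt_def
  set Fs : ℝ → ℝ := fun t => (t + 15) * (t - 9) * (t - 10) * (t - 34) * (t - 36) * (t - 60) with hFs_def
  set Ψ : ℝ → ℝ → ℝ := fun y t => 25 * (y - 6) * (y - 13) * (t - 36) * (t - 60) * (y - t) with hΨ_def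
  have defs : (∀ t, a t = t ^ 2 - 44 * t + 990) ∧ (∀ t, b t = -45 * t ^ 2 + 680 * t - 15300) ∧
      (∀ t, c t = 650 * t ^ 2) ∧ (∀ t, a₁ t = 2 * t - 44) ∧ (∀ t, b₁ t = -90 * t + 680) ∧
      (∀ t, c₁ t = 1300 * t) ∧ (∀ y, P y = y ^ 2 - 45 * y + 650) ∧ (∀ y, Q y = -44 * y ^ 2 + 680 * y) ∧
      (∀ y, R y = 990 * y ^ 2 - 15300 * y) ∧
      (∀ y, Ft y = y * (y - 6) * (y - 13) * (y - 30) * (y - 40) * (y - 45)) ∧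
      (∀ t, Fs t = (t + 15) * (t - 9) * (t - 10) * (t - 34) * (t - 36) * (t - 60)) ∧
      (∀ y t, Ψ y t = 25 * (y - 6) * (y - 13) * (t - 36) * (t - 60) * (y - t)) :=
    ⟨fun _ => rfl, fun _ => rfl, fun _ => rfl, fun _ => rfl, fun _ => rfl, fun _ => rfl, fun _ => rfl,
      fun _ => rfl, fun _ => rfl, fun _ => rfl, fun _ => rfl, fun _ _ => rfl⟩
  obtain ⟨ea, eb, ec, ea₁, eb₁, ec₁, eP, eQ, eR, eFt, eFs, eΨ⟩ := defs
  -- hypotheses of `correspondence_transfer`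
  have hexp : ∀ y t : ℝ, a t * y ^ 2 + b t * y + c t = P y * t ^ 2 + Q y * t + R y := by
    intro y t; rw [ea, eb, ec, eP, eQ, eR]; ring
  have hda : ∀ t, HasDerivAt a (a₁ t) t := fun t =>
    (hasDerivAt_quad 1 (-44) 990 t (fun u => by rw [ea]; ring)).congr_deriv (by rw [ea₁]; ring)
  have hdb : ∀ t, HasDerivAt b (b₁ t) t := fun t =>
    (hasDerivAt_quad (-45) 680 (-15300) t (fun u => by rw [eb]; ring)).congr_deriv (by rw [eb₁]; ring)
  have hdc : ∀ t, HasDerivAt c (c₁ t) t := fun t =>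
    (hasDerivAt_quad 650 0 0 t (fun u => by rw [ec]; ring)).congr_deriv (by rw [ec₁]; ring)
  have hsa : ∀ σ : Set (Fin 1 → ℝ), IsSemialgebraic ℚ σ → IsSemialgebraicFunOn ℚ σ (fun p => a (p 0)) :=
    fun σ hσ => poly_semialgebraic hσ (MvPolynomial.X 0 ^ 2 - 44 * MvPolynomial.X 0 + 990) a
      (fun x => by rw [ea]; simp)
  have hsb : ∀ σ : Set (Fin 1 → ℝ), IsSemialgebraic ℚ σ → IsSemialgebraicFunOn ℚ σ (fun p => b (p 0)) :=
    fun σ hσ => poly_semialgebraic hσ (-45 * MvPolynomial.X 0 ^ 2 + 680 * MvPolynomial.X 0 - 15300) b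
      (fun x => by rw [eb]; simp)
  have hsc : ∀ σ : Set (Fin 1 → ℝ), IsSemialgebraic ℚ σ → IsSemialgebraicFunOn ℚ σ (fun p => c (p 0)) :=
    fun σ hσ => poly_semialgebraic hσ (650 * MvPolynomial.X 0 ^ 2) c (fun x => by rw [ec]; simp)
  have hsa₁ : ∀ σ : Set (Fin 1 → ℝ), IsSemialgebraic ℚ σ → IsSemialgebraicFunOn ℚ σ (fun p => a₁ (p 0)) :=
    fun σ hσ => poly_semialgebraic hσ (2 * MvPolynomial.X 0 - 44) a₁ (fun x => by rw [ea₁]; simp)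
  have hsb₁ : ∀ σ : Set (Fin 1 → ℝ), IsSemialgebraic ℚ σ → IsSemialgebraicFunOn ℚ σ (fun p => b₁ (p 0)) :=
    fun σ hσ => poly_semialgebraic hσ (-90 * MvPolynomial.X 0 + 680) b₁ (fun x => by rw [eb₁]; simp)
  have hsc₁ : ∀ σ : Set (Fin 1 → ℝ), IsSemialgebraic ℚ σ → IsSemialgebraicFunOn ℚ σ (fun p => c₁ (p 0)) :=
    fun σ hσ => poly_semialgebraic hσ (1300 * MvPolynomial.X 0) c₁ (fun x => by rw [ec₁]; simp)
  have hΦP : ∀ y t : ℝ, a t * y ^ 2 + b t * y + c t = 0 →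
      (y ^ 2 - 45 * y + 650) * t ^ 2 + (-44 * y ^ 2 + 680 * y) * t + (990 * y ^ 2 - 15300 * y) = 0 := by
    intro y t h; rw [ea, eb, ec] at h; linear_combination h
  have hnorm : ∀ y t : ℝ, a t * y ^ 2 + b t * y + c t = 0 → Ft y * Fs t = Ψ y t ^ 2 := by
    intro y t h
    have c0 := cert0_norm y t
    rw [hΦP y t h, zero_mul, sub_eq_zero] at c0
    rw [eFt, eFs, eΨ]
    linear_combination c0
  have hcert : ∀ y t : ℝ, a t * y ^ 2 + b t * y + c t = 0 →
      Ft y * (2 * a t * y + b t) + 1 * (P y * (y + t) + Q y) * Ψ y t = 0 := by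
    intro y t h
    have c0 := cert0_trace_x y t
    rw [hΦP y t h, zero_mul] at c0
    rw [eFt, ea, eb, eP, eQ, eΨ]
    linear_combination c0
  have ha : ∀ t : ℝ, ((-15 : ℚ) : ℝ) < t → t < ((9 : ℚ) : ℝ) → 0 < a t := by
    intro t _ _; rw [ea]; nlinarith [sq_nonneg (t - 22)]
  have hd : ∀ t : ℝ, ((-15 : ℚ) : ℝ) < t → t < ((9 : ℚ) : ℝ) → t ≠ ((0 : ℚ) : ℝ) →
      0 < b t ^ 2 - 4 * a t * c t := by
    intro t h1 h2 _
    push_cast at h1 h2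
    rw [ea, eb, ec, show (-45 * t ^ 2 + 680 * t - 15300) ^ 2 - 4 * (t ^ 2 - 44 * t + 990) * (650 * t ^ 2) =
      25 * (t + 18) * (10 - t) * (34 - t) * (1530 - 23 * t) by ring]
    exact mul_pos (mul_pos (mul_pos (mul_pos (by norm_num) (by linarith)) (by linarith)) (by linarith))
      (by linarith)
  -- the quadratic in `x` over a point `t` of the source: continuity and values at 0, 6, 13, 30
  have hcx : ∀ t : ℝ, Continuous (fun y : ℝ => a t * y ^ 2 + b t * y + c t) := by
    intro t; rw [ea, eb, ec]; fun_prop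
  have hv0 : ∀ t : ℝ, a t * (0 : ℝ) ^ 2 + b t * 0 + c t = 650 * t ^ 2 := by intro t; rw [ec]; ring
  have hv6 : ∀ t : ℝ, a t * (6 : ℝ) ^ 2 + b t * 6 + c t = 416 * (t + 15) * (t - 9) := by
    intro t; rw [ea, eb, ec]; ring
  have hv13 : ∀ t : ℝ, a t * (13 : ℝ) ^ 2 + b t * 13 + c t = 234 * (t + 15) * (t - 9) := by
    intro t; rw [ea, eb, ec]; ring
  have hv30 : ∀ t : ℝ, a t * (30 : ℝ) ^ 2 + b t * 30 + c t = 200 * (t - 36) * (t - 60) := by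
    intro t; rw [ea, eb, ec]; ring
  have hyroots : ∀ t : ℝ, ((-15 : ℚ) : ℝ) < t → t < ((9 : ℚ) : ℝ) → t ≠ ((0 : ℚ) : ℝ) →
      (∃ y : ℝ, ((0 : ℚ) : ℝ) < y ∧ y < ((6 : ℚ) : ℝ) ∧ a t * y ^ 2 + b t * y + c t = 0) ∧
        ∃ y' : ℝ, ((13 : ℚ) : ℝ) < y' ∧ y' < ((30 : ℚ) : ℝ) ∧ a t * y' ^ 2 + b t * y' + c t = 0 := by
    intro t ht1 ht2 ht0
    push_cast at ht1 ht2 ht0 ⊢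
    have hneg : (t + 15) * (t - 9) < 0 := mul_neg_of_pos_of_neg (by linarith) (by linarith)
    constructor
    · have h0 : (0 : ℝ) ∈ Ioo (a t * (6 : ℝ) ^ 2 + b t * 6 + c t) (a t * (0 : ℝ) ^ 2 + b t * 0 + c t) := by
        rw [hv0, hv6]
        exact ⟨by nlinarith, by positivity⟩
      obtain ⟨y, hy, hy0⟩ := intermediate_value_Ioo' (show (0 : ℝ) ≤ 6 by norm_num) (hcx t).continuousOn h0
      exact ⟨y, hy.1, hy.2, hy0⟩
    · have h0 : (0 : ℝ) ∈ Ioo (a t * (13 : ℝ) ^ 2 + b t * 13 + c t) (a t * (30 : ℝ) ^ 2 + b t * 30 + c t) := by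
        rw [hv13, hv30]
        exact ⟨by nlinarith, by nlinarith [mul_pos_of_neg_of_neg (by linarith : t - 36 < 0) (by linarith : t - 60 < 0)]⟩
      obtain ⟨y, hy, hy0⟩ := intermediate_value_Ioo (show (13 : ℝ) ≤ 30 by norm_num) (hcx t).continuousOn h0
      exact ⟨y, hy.1, hy.2, hy0⟩
  have hsep : ∀ y y' : ℝ, ((0 : ℚ) : ℝ) < y → y < ((6 : ℚ) : ℝ) → ((13 : ℚ) : ℝ) < y' → y' < ((30 : ℚ) : ℝ) →
      0 < (((-1 : ℚ)) : ℝ) * (y - y') := by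
    intro y y' _ hy hy' _
    push_cast at hy hy' ⊢
    nlinarith
  have hP : ∀ y : ℝ, ((0 : ℚ) : ℝ) < y → y < ((6 : ℚ) : ℝ) → P y ≠ 0 := by
    intro y _ _; rw [eP]; nlinarith [sq_nonneg (2 * y - 45)]
  -- the quadratic in `t` over a point `y` of the target: continuity and values at −15, 0, y, 9
  have hct : ∀ y : ℝ, Continuous (fun t : ℝ => a t * y ^ 2 + b t * y + c t) := by
    intro y; simp only [ea, eb, ec]; fun_prop
  have hw15 : ∀ y : ℝ, a (-15) * y ^ 2 + b (-15) * y + c (-15) = 1875 * (y - 6) * (y - 13) := by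
    intro y; rw [ea, eb, ec]; ring
  have hw0 : ∀ y : ℝ, a 0 * y ^ 2 + b 0 * y + c 0 = 90 * y * (11 * y - 170) := by
    intro y; rw [ea, eb, ec]; ring
  have hwy : ∀ y : ℝ, a y * y ^ 2 + b y * y + c y = y * (y - 45) * (y - 10) * (y - 34) := by
    intro y; rw [ea, eb, ec]; ring
  have hw9 : ∀ y : ℝ, a 9 * y ^ 2 + b 9 * y + c 9 = 675 * (y - 6) * (y - 13) := by
    intro y; rw [ea, eb, ec]; ring
  have htroots : ∀ y : ℝ, ((0 : ℚ) : ℝ) < y → y < ((6 : ℚ) : ℝ) →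
      (∃ t : ℝ, ((-15 : ℚ) : ℝ) < t ∧ t < ((0 : ℚ) : ℝ) ∧ t < y ∧ a t * y ^ 2 + b t * y + c t = 0) ∧
        ∃ t : ℝ, ((0 : ℚ) : ℝ) < t ∧ t < ((9 : ℚ) : ℝ) ∧ y < t ∧ a t * y ^ 2 + b t * y + c t = 0 := by
    intro y hy1 hy2
    push_cast at hy1 hy2 ⊢
    have hpos : 0 < (y - 6) * (y - 13) := mul_pos_of_neg_of_neg (by linarith) (by linarith)
    constructor
    · have h0 : (0 : ℝ) ∈ Ioo (a 0 * y ^ 2 + b 0 * y + c 0) (a (-15) * y ^ 2 + b (-15) * y + c (-15)) := by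
        rw [hw0, hw15]
        exact ⟨by nlinarith, by nlinarith⟩
      obtain ⟨t, ht, ht0⟩ := intermediate_value_Ioo' (show (-15 : ℝ) ≤ 0 by norm_num) (hct y).continuousOn h0
      exact ⟨t, ht.1, ht.2, by linarith [ht.2], ht0⟩
    · have h0 : (0 : ℝ) ∈ Ioo (a y * y ^ 2 + b y * y + c y) (a 9 * y ^ 2 + b 9 * y + c 9) := by
        rw [hwy, hw9]
        refine ⟨?_, by nlinarith⟩
        have h1 : 0 < y * (45 - y) := mul_pos hy1 (by linarith)
        have h2 : 0 < (10 - y) * (34 - y) := mul_pos (by linarith) (by linarith)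
        nlinarith [mul_pos h1 h2]
      obtain ⟨t, ht, ht0⟩ := intermediate_value_Ioo (show y ≤ 9 by linarith) (hct y).continuousOn h0
      exact ⟨t, by linarith [ht.1], ht.2, ht.1, ht0⟩
  have hDz : ∀ y : ℝ, ((0 : ℚ) : ℝ) < y → y < ((6 : ℚ) : ℝ) → Q y ^ 2 - 4 * P y * R y ≠ 0 := by
    intro y hy1 hy2
    push_cast at hy1 hy2
    rw [eP, eQ, eR, show (-44 * y ^ 2 + 680 * y) ^ 2 - 4 * (y ^ 2 - 45 * y + 650) * (990 * y ^ 2 - 15300 * y) =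
      -8 * y * (11 * y - 170) * (23 * y - 650) * (y - 45) by ring]
    refine mul_ne_zero (mul_ne_zero (mul_ne_zero (mul_ne_zero (by norm_num) hy1.ne') ?_) ?_) ?_
    · exact (by linarith : (11 : ℝ) * y - 170 < 0).ne
    · exact (by linarith : (23 : ℝ) * y - 650 < 0).ne
    · exact (by linarith : y - 45 < 0).ne
  have hFt : ∀ y : ℝ, ((0 : ℚ) : ℝ) < y → y < ((6 : ℚ) : ℝ) → Ft y ≠ 0 := by
    intro y hy1 hy2
    push_cast at hy1 hy2
    rw [eFt]
    refine mul_ne_zero (mul_ne_zero (mul_ne_zero (mul_ne_zero (mul_ne_zero hy1.ne' ?_) ?_) ?_) ?_) ?_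
    all_goals exact (by linarith : _ < (0 : ℝ)).ne
  have hFs : ∀ t : ℝ, ((-15 : ℚ) : ℝ) < t → t < ((9 : ℚ) : ℝ) → t ≠ ((0 : ℚ) : ℝ) → Fs t ≠ 0 := by
    intro t ht1 ht2 _
    push_cast at ht1 ht2
    rw [eFs]
    refine mul_ne_zero (mul_ne_zero (mul_ne_zero (mul_ne_zero (mul_ne_zero ?_ ?_) ?_) ?_) ?_) ?_
    · exact (by linarith : (0 : ℝ) < t + 15).ne'
    all_goals exact (by linarith : _ < (0 : ℝ)).ne
  have hr : r.domain = {p | ((-15 : ℚ) : ℝ) < p 0 ∧ p 0 < ((9 : ℚ) : ℝ)} := by push_cast; exact h1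
  have hs : r'.domain = {p | ((0 : ℚ) : ℝ) < p 0 ∧ p 0 < ((6 : ℚ) : ℝ)} := by push_cast; exact h3
  have hg : EqOn r.integrand (fun p => 1 * ((α : ℝ) + (β : ℝ) * p 0) / Real.sqrt |Fs (p 0)|) r.domain := by
    intro p hp; rw [h2 hp]; beta_reduce; rw [eFs, one_mul]
  have hf : EqOn r'.integrand (fun p => 1 * ((α : ℝ) + (β : ℝ) * p 0) / Real.sqrt |Ft (p 0)|) r'.domain := by
    intro p hp; rw [h4 hp]
  exact correspondence_transfer a b c a₁ b₁ c₁ P Q R Ft Fs Ψ 1 1 1 (α : ℝ) (β : ℝ) (-1) (-15) 0 9 0 6 13 30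
    r r' (Or.inl rfl) (by norm_num) (by norm_num) hexp hda hdb hdc hsa hsb hsc hsa₁ hsb₁ hsc₁ hnorm hcert
    (by simp) ha hd hyroots hsep hP htroots hDz hFt hFs hr hg hs hf

end Summit.KontsevichZagierPeriods.IsogenyCertificates.RichelotChain

end
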